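import Literature.AlgebraicGeometry.Motives.ClosedSubfunctorRepresentable
import Mathlib.AlgebraicGeometry.Morphisms.Immersion
import HarnessLib

/-!
# A subfunctor cut out by an open (resp. locally closed) condition is represented by an open subscheme
# (resp. by an immersion)

Topic `AlgebraicGeometry/Motives`; namespace `Literature.AlgebraicGeometry.Motives`.  THEOREMS ONLY (no definition, no
instance, no notation, no named fact, no `sorry`).  The OPEN twin of ★ `ClosedSubfunctorRepresentable` ((A9)) in the
currency of ★ `OpenSubfunctorCover` ((A-oc), Görtz–Wedhorn Thm. 8.9): the condition attached to a `T`-point `x` is an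
open set `U x : T.Opens` and the membership rule is

  `hU : F.map h.op x ∈ P(T') ↔ Set.range h ⊆ U x`      (`h : T' ⟶ T`; «`h` lands in the open set of the condition»).

If `F` is represented by a scheme `X` (`eX : h_X ≅ F`, universal element `x₀ = eX(𝟙 X)`), then `P` is represented by
the OPEN SUBSCHEME `U x₀ ↪ X` (Mathlib `Scheme.Opens.ι`, universal property `IsOpenImmersion.lift`), and the classifying
morphism of ANY representing pair of `P` is an open immersion with range `U x₀`; §3: a CLOSED condition (ideal-sheaf
currency of (A9)) on such an open-condition subfunctor is represented with classifying morphism an IMMERSION (Mathlib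
`IsImmersion`) — the «locally closed subfunctor» shape (flattening strata, [MumfordFogartyKirwan1994, Ch. 0 §5 (d)];
open and closed conditions of [GortzWedhorn2020, (8.4), Thm. 8.9 (p. 212)]).

* §1 `exists_comp_opensι_eq_iff_range_subset`, `existsUnique_comp_opensι_eq_iff_range_subset` — universal property of
  `V.ι : V ↪ X` for `V : X.Opens`.
* §2 **`app_mem_iff_range_subset`**, **`exists_iso_yoneda_opens`** (hence `P.toFunctor.IsRepresentable` — same one-liner
  as ★ `isRepresentable_of_closedCondition`, not restated), **`isOpenImmersion_of_openCondition`**, `range_eq_of_openCondition`.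
* §3 **`isImmersion_of_closedCondition_of_openCondition`**.

Cell `hodgecm-mathlib` (D-0151), count-neutral Mathlib-side capital; nothing here is about HC — HC_CM is proved only modulo
the 7 printed citations until rung 0 closes.
-/

universe u

open CategoryTheory Opposite _root_.AlgebraicGeometry

namespace Literature.AlgebraicGeometry.Motives

/-! ## §1 The universal property of an open subscheme `V ↪ X` -/

/-- **Universal property of an open subscheme** (existence): `g : T ⟶ X` factors through `V.ι : V ↪ X` iff its image
lies in `V`. [cite: GortzWedhorn2020, Thm. 8.9 (p. 212)] -/
theorem exists_comp_opensι_eq_iff_range_subset {T X : Scheme.{u}} (V : X.Opens) (g : T ⟶ X) :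
    (∃ g' : T ⟶ (V : Scheme.{u}), g' ≫ V.ι = g) ↔ Set.range g ⊆ (V : Set X) := by
  constructor
  · rintro ⟨g', rfl⟩
    rintro _ ⟨t, rfl⟩
    rw [Scheme.Hom.comp_apply]
    exact Scheme.Opens.range_ι V ▸ Set.mem_range_self _
  · intro h
    exact ⟨IsOpenImmersion.lift V.ι g (by rwa [Scheme.Opens.range_ι]), IsOpenImmersion.lift_fac _ _ _⟩

/-- **Universal property of an open subscheme** (unique factorisation; `V ↪ X` is a monomorphism).
[cite: GortzWedhorn2020, Thm. 8.9 (p. 212)] -/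
theorem existsUnique_comp_opensι_eq_iff_range_subset {T X : Scheme.{u}} (V : X.Opens) (g : T ⟶ X) :
    (∃! g' : T ⟶ (V : Scheme.{u}), g' ≫ V.ι = g) ↔ Set.range g ⊆ (V : Set X) := by
  rw [← exists_comp_opensι_eq_iff_range_subset V g]
  refine ⟨fun h => h.exists, fun ⟨g', hg'⟩ => ⟨g', hg', fun g'' hg'' => ?_⟩⟩
  exact (cancel_mono V.ι).mp (hg''.trans hg'.symm)

/-! ## §2 Open conditions on a representable functor -/

section OpenCondition

variable {F : Scheme.{u}ᵒᵖ ⥤ Type u} {X : Scheme.{u}} (eX : yoneda.obj X ≅ F) (P : Subfunctor F)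
  (U : ∀ {T : Scheme.{u}}, F.obj (op T) → T.Opens)
  (hU : ∀ {T T' : Scheme.{u}} (x : F.obj (op T)) (h : T' ⟶ T),
    F.map h.op x ∈ P.obj (op T') ↔ Set.range h ⊆ (U x : Set T))

/-- The value of a representing isomorphism `eX : h_X ≅ F` on `f : T ⟶ X` is the pull-back of the universal element
`x₀ = eX(𝟙 X)`: `eX f = F(f) x₀`. [folklore] -/
private theorem app_eq_map_app_id' {T : Scheme.{u}} (f : T ⟶ X) :
    eX.hom.app (op T) f = F.map f.op (eX.hom.app (op X) (𝟙 X)) := by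
  have h := NatTrans.naturality_apply eX.hom f.op (𝟙 X)
  simp only [yoneda_obj_map, Quiver.Hom.unop_op] at h
  exact h

include hU in
/-- **Membership is the open condition at the universal element**: for `f : T ⟶ X`, `eX f ∈ P(T)` iff `f` lands in
`U x₀` (`x₀ = eX(𝟙 X)`). [cite: GortzWedhorn2020, Thm. 8.9 (p. 212)] -/
theorem app_mem_iff_range_subset {T : Scheme.{u}} (f : T ⟶ X) :
    eX.hom.app (op T) f ∈ P.obj (op T) ↔ Set.range f ⊆ (U (eX.hom.app (op X) (𝟙 X)) : Set X) := by
  rw [app_eq_map_app_id' eX f]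
  exact hU _ f

include hU in
/-- **An open condition is represented by the open subscheme `U x₀ ↪ X`**: there is an isomorphism `e : h_{U x₀} ≅ P`
under which the inclusion `P ↪ F ≅ h_X` is (Yoneda of) the open immersion `(U x₀).ι`.
[cite: GortzWedhorn2020, Thm. 8.9 (p. 212)] -/
theorem exists_iso_yoneda_opens :
    ∃ e : yoneda.obj (U (eX.hom.app (op X) (𝟙 X)) : Scheme.{u}) ≅ P.toFunctor,
      e.hom ≫ P.ι = yoneda.map (U (eX.hom.app (op X) (𝟙 X))).ι ≫ eX.hom := by
  set V := U (eX.hom.app (op X) (𝟙 X)) with hV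
  -- membership of `eX (g ≫ ι)` for every `g : T ⟶ V`
  have hmem : ∀ (T : Scheme.{u}) (g : T ⟶ (V : Scheme.{u})), eX.hom.app (op T) (g ≫ V.ι) ∈ P.obj (op T) :=
    fun T g => (app_mem_iff_range_subset eX P U hU _).2 ((exists_comp_opensι_eq_iff_range_subset V _).1 ⟨g, rfl⟩)
  -- the forward natural transformation `h_V ⟶ P`
  let φ : yoneda.obj (V : Scheme.{u}) ⟶ P.toFunctor :=
    Subfunctor.lift (yoneda.map V.ι ≫ eX.hom) (by
      intro W y hy
      obtain ⟨T⟩ := W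
      obtain ⟨g, rfl⟩ := hy
      exact hmem T g)
  have hφι : φ ≫ P.ι = yoneda.map V.ι ≫ eX.hom := Subfunctor.lift_ι _ _
  have hbij : ∀ T : Scheme.{u}ᵒᵖ, Function.Bijective (φ.app T) := by
    rintro ⟨T⟩
    constructor
    · intro g g' hgg'
      have h1 := congrArg (fun y : P.toFunctor.obj (op T) => eX.inv.app (op T) y.1) hgg'
      have hφapp : ∀ g : T ⟶ (V : Scheme.{u}), (φ.app (op T) g).1 = eX.hom.app (op T) (g ≫ V.ι) :=
        fun g => rfl
      simp only [hφapp] at h1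
      have h2 : g ≫ V.ι = g' ≫ V.ι := by
        simpa [← types_comp_apply (eX.hom.app _) (eX.inv.app _), ← NatTrans.comp_app] using h1
      exact (cancel_mono V.ι).mp h2
    · rintro ⟨y, hy⟩
      set f : T ⟶ X := eX.inv.app (op T) y with hf
      have hle : Set.range f ⊆ (V : Set X) := by
        have := (app_mem_iff_range_subset eX P U hU f).1
        rw [hf, ← types_comp_apply (eX.inv.app _) (eX.hom.app _), ← NatTrans.comp_app, Iso.inv_hom_id,
          NatTrans.id_app, types_id_apply] at this
        exact this hy
      obtain ⟨g, hg⟩ := (exists_comp_opensι_eq_iff_range_subset V f).2 hle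
      refine ⟨g, Subtype.ext ?_⟩
      change eX.hom.app (op T) (g ≫ V.ι) = y
      rw [hg, hf, ← types_comp_apply (eX.inv.app _) (eX.hom.app _), ← NatTrans.comp_app, Iso.inv_hom_id,
        NatTrans.id_app, types_id_apply]
  haveI : ∀ T, IsIso (φ.app T) := fun T => (isIso_iff_bijective _).2 (hbij T)
  haveI : IsIso φ := NatIso.isIso_of_isIso_app φ
  exact ⟨asIso φ, hφι⟩

include hU in
/-- The classifying morphism of a representing pair of an open-condition subfunctor factors as an isomorphism followed by
the open immersion `(U x₀).ι`. [cite: GortzWedhorn2020, Thm. 8.9 (p. 212)] -/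
theorem exists_eq_iso_comp_opensι_of_openCondition {Y : Scheme.{u}} (e : yoneda.obj Y ≅ P.toFunctor) (g : Y ⟶ X)
    (hg : yoneda.map g ≫ eX.hom = e.hom ≫ P.ι) :
    ∃ ψ : Y ≅ (U (eX.hom.app (op X) (𝟙 X)) : Scheme.{u}), g = ψ.hom ≫ (U (eX.hom.app (op X) (𝟙 X))).ι := by
  obtain ⟨e₀, he₀⟩ := exists_iso_yoneda_opens eX P U hU
  let ψ : Y ≅ (U (eX.hom.app (op X) (𝟙 X)) : Scheme.{u}) := Yoneda.fullyFaithful.preimageIso (e ≪≫ e₀.symm)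
  have hψ : yoneda.map ψ.hom = e.hom ≫ e₀.inv := by
    simp only [ψ, Functor.FullyFaithful.preimageIso_hom, Functor.FullyFaithful.map_preimage, Iso.trans_hom,
      Iso.symm_hom]
  refine ⟨ψ, ?_⟩
  apply yoneda.map_injective
  apply (cancel_mono eX.hom).mp
  rw [hg, yoneda.map_comp, Category.assoc, ← he₀, hψ, Category.assoc, Iso.inv_hom_id_assoc]

include hU in
/-- **The classifying morphism of an open condition is an open immersion**: for ANY representing pair
`(Y, e : h_Y ≅ P)`, the morphism `g : Y ⟶ X` with `h_g ≫ eX = e ≫ (P ↪ F)` is an open immersion.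
[cite: GortzWedhorn2020, Thm. 8.9 (p. 212)] -/
theorem isOpenImmersion_of_openCondition {Y : Scheme.{u}} (e : yoneda.obj Y ≅ P.toFunctor) (g : Y ⟶ X)
    (hg : yoneda.map g ≫ eX.hom = e.hom ≫ P.ι) : IsOpenImmersion g := by
  obtain ⟨ψ, rfl⟩ := exists_eq_iso_comp_opensι_of_openCondition eX P U hU e g hg
  infer_instance

include hU in
/-- … and its image is exactly the open set `U x₀` of the condition at the universal element.
[cite: GortzWedhorn2020, Thm. 8.9 (p. 212)] -/
theorem range_eq_of_openCondition {Y : Scheme.{u}} (e : yoneda.obj Y ≅ P.toFunctor) (g : Y ⟶ X)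
    (hg : yoneda.map g ≫ eX.hom = e.hom ≫ P.ι) : Set.range g = (U (eX.hom.app (op X) (𝟙 X)) : Set X) := by
  obtain ⟨ψ, rfl⟩ := exists_eq_iso_comp_opensι_of_openCondition eX P U hU e g hg
  rw [range_eq_range_of_surjective (ψ.hom ≫ (U (eX.hom.app (op X) (𝟙 X))).ι) _ ψ.hom rfl,
    Scheme.Opens.range_ι]

end OpenCondition

/-! ## §3 Locally closed conditions: a closed condition on an open-condition subfunctor -/

section LocallyClosed

variable {F : Scheme.{u}ᵒᵖ ⥤ Type u} {X : Scheme.{u}} (eX : yoneda.obj X ≅ F) (P : Subfunctor F)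
  (U : ∀ {T : Scheme.{u}}, F.obj (op T) → T.Opens)
  (hU : ∀ {T T' : Scheme.{u}} (x : F.obj (op T)) (h : T' ⟶ T),
    F.map h.op x ∈ P.obj (op T') ↔ Set.range h ⊆ (U x : Set T))
  (Q : Subfunctor P.toFunctor) (I : ∀ {T : Scheme.{u}}, P.toFunctor.obj (op T) → T.IdealSheafData)
  (hI : ∀ {T T' : Scheme.{u}} (y : P.toFunctor.obj (op T)) (h : T' ⟶ T),
    P.toFunctor.map h.op y ∈ Q.obj (op T') ↔ I y ≤ h.ker)

include eX hU hI in
/-- **A locally closed subfunctor is representable**: a closed condition `Q ⊆ P` (ideal-sheaf currency of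
★ `ClosedSubfunctorRepresentable`) on an open-condition subfunctor `P ⊆ F ≅ h_X` is representable.
[cite: GortzWedhorn2020, Thm. 8.9 (p. 212)] [cite: MumfordFogartyKirwan1994, Ch. 6 §3 Prop. 6.16 (p. 126)] -/
theorem isRepresentable_of_closedCondition_of_openCondition : Q.toFunctor.IsRepresentable := by
  obtain ⟨eP, -⟩ := exists_iso_yoneda_opens eX P U hU
  exact isRepresentable_of_closedCondition eP Q I hI

include hU hI in
/-- **The classifying morphism of a locally closed condition is an immersion**: for ANY representing pair
`(Z, e : h_Z ≅ Q)` of a closed condition `Q` on an open-condition subfunctor `P ⊆ F ≅ h_X`, the morphism `g : Z ⟶ X`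
with `h_g ≫ eX = e ≫ (Q ↪ P ↪ F)` is an immersion (a closed immersion into the open subscheme `U x₀`, followed by its open
immersion into `X`). [cite: GortzWedhorn2020, Thm. 8.9 (p. 212)] [cite: MumfordFogartyKirwan1994, Ch. 6 §3 Prop. 6.16 (p. 126)] -/
theorem isImmersion_of_closedCondition_of_openCondition {Z : Scheme.{u}} (e : yoneda.obj Z ≅ Q.toFunctor)
    (g : Z ⟶ X) (hg : yoneda.map g ≫ eX.hom = e.hom ≫ Q.ι ≫ P.ι) : IsImmersion g := by
  obtain ⟨eP, heP⟩ := exists_iso_yoneda_opens eX P U hU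
  -- the classifying morphism `g₁ : Z ⟶ U x₀` of `Q ⊆ P ≅ h_{U x₀}`
  let g₁ : Z ⟶ (U (eX.hom.app (op X) (𝟙 X)) : Scheme.{u}) := Yoneda.fullyFaithful.preimage (e.hom ≫ Q.ι ≫ eP.inv)
  have hg₁ : yoneda.map g₁ ≫ eP.hom = e.hom ≫ Q.ι := by
    simp only [g₁, Functor.FullyFaithful.map_preimage, Category.assoc, Iso.inv_hom_id, Category.comp_id]
  haveI : IsClosedImmersion g₁ := isClosedImmersion_of_closedCondition eP Q I hI e g₁ hg₁
  have hfac : g = g₁ ≫ (U (eX.hom.app (op X) (𝟙 X))).ι := by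
    apply yoneda.map_injective
    apply (cancel_mono eX.hom).mp
    rw [hg, yoneda.map_comp, Category.assoc, ← heP, reassoc_of% hg₁]
  rw [hfac]
  infer_instance

end LocallyClosed

end Literature.AlgebraicGeometry.Motives
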